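import Summits.FinalStateConjecture.FinalStateConjecture.Theses.ExactKerrEnds
import HarnessLib

/-!
# Route ExactKerrEnds — the assembly item (stmt-FinalStateConjecture-18524)

The assembly item of route `ExactKerrEnds` is the implication
`TameEscapeToKerrEnds → CensorshipAlongKerrEnds → SettlingAlongCensoredKerrEnds → MGHDExists →
FinalStateConjecture`, which is literally the type of the route's deciding theorem
`Theses.ExactKerrEnds.closes` (two applications of the patching lemma
`InitialDataSet.isTameChristodoulouGeneric_of_relative'` along tame curves plus monotonicity of
tame genericity for the anti-vacuity conjunct). This file closes the item by that theorem.
-/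

-- The tree namespace `Summit.FinalStateConjecture.FinalStateConjecture.…` (summit = sub-problem)
-- repeats a component by design (D-0022), which the `dupNamespace` linter would flag on every decl.
set_option linter.dupNamespace false

namespace Summit.FinalStateConjecture.FinalStateConjecture.Theorems.ExactKerrEnds

/-- **Assembly of route ExactKerrEnds** (item stmt-FinalStateConjecture-18524): tame escape to
Kerr ends, censorship along Kerr-ended curves, settling along censored Kerr-ended curves and MGHD
existence together imply the Final State Conjecture — by the route's deciding theorem `closes`. -/
theorem assembly_proof :
    Summit.FinalStateConjecture.FinalStateConjecture.Theses.ExactKerrEnds.Assembly := by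
  unfold Summit.FinalStateConjecture.FinalStateConjecture.Theses.ExactKerrEnds.Assembly
  intro hE hC hS hM
  exact Summit.FinalStateConjecture.FinalStateConjecture.Theses.ExactKerrEnds.closes hE hC hS hM

end Summit.FinalStateConjecture.FinalStateConjecture.Theorems.ExactKerrEnds
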